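import Summits.CriticalPhenomena.PercolationContinuityZ3.Theorems.Transplant.FKConnectivityAllQAntipodalAndStar3Erase
import HarnessLib

/-!
# Connectivity correlation inequalities for `φ_{w,q}`, every `q > 0` — file 32b: `C_∞(and)` AT EVERY LEVEL — the DOUBLED-ROOT decomposition
# and the trivial cases of the general AND-drift

Support file (`--supports stmt-CriticalPhenomena-4575`), FK sub-lane `prim-bschramm-fk-2` (gen 19) of the post-continuity programme; builds
on p205010 (kernel theorem, internal audit signed; external expert review pending).  No definitions, no named facts, no sorries; standard axioms.

The general AND-drift `D(N, A, C; e) = ∑_{γ ⊆ N} (q^{k(γ∪A∪e)+k((N\γ)∪C)} - q^{k((N\γ)∪A∪e)+k(γ∪C)}) h(γ)` (free set `N`, `S`-side attached set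
`A`, contracted set `C`, root `e`).  The induction of file 32c (over the two-terminal series–parallel structure of the host minus the root,
by the general series and parallel junction identities of files 32/32a) meets, across a series junction `E₁(s,m) · E₂(m,t)`, the drift of
side 1 with the VIRTUAL root `sm`, which may already be an edge of `E₁`.  This file supplies the case analysis tools:
* `FK.andGen_doubled` — if the virtual root `e` is a FREE edge (`e ∈ N`), split `γ` by its `e`-coordinate: `D(N, A, C; e)` is
  `D(N \ e, A, C; e)` against `h(· ∪ e)` plus the ROOTLESS drift with `e` attached and contracted (`A ∪ e`, `C ∪ e`) against `h`, plus
  `∑ (q^{Z̄'+Φ'} - q^{Z̄'+B'})(h(γ'∪e) - h(γ'))` with `B' = k(γ'∪C∪e) ≤ Φ' = k(γ'∪C)` — so the two recursive inputs imply `D ≤ 0`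
  (`0 < q ≤ 1`, `h` monotone); the lemma is stated with the two inputs as hypotheses;
* `FK.andGen_sum_empty`, `FK.andGen_rootless_self` — the drift over `N = ∅` and the rootless drift with `A = C` vanish identically;
* `FK.IsTTSP.reroot_erase` — Duffin re-rooting with the old root kept and the new root removed: `F` TTSP between `u, v`, `xy ∈ F ∪ {uv}`,
  `F ∪ {uv} ≠ {xy}` ⇒ `(F ∪ {uv}) \ xy` is TTSP between `x, y` (`IsTTSP.insert_edge_of_mem` + `IsTTSP.erase_terminal_edge`): every attached,
  non-contracted edge can serve as the root of a recursive call, the old root becoming an ordinary (deleted, attached or contracted) edge.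
[cite: Grimmett2006, §1.4 eq. (1.20) (p. 15); §3.8 Thm. (3.90) (pp. 61–62); §3.9 (pp. 63–64)] [cite: Wagner2006, Thm. 5.8(d), §5.3]
-/

noncomputable section

namespace Summit.CriticalPhenomena.PercolationContinuityZ3.Theorems

namespace FK

open SimpleGraph Literature.Probability.LatticeModels Literature.Probability.Percolation
open scoped Classical

variable {V : Type*} [Fintype V]

section GenSides

variable {u v x y : V}

omit [Fintype V] in
/-- **Duffin re-rooting with the new root removed**: `F` TTSP between `u, v`, `xy ∈ F ∪ {uv}`, `F ∪ {uv} ≠ {xy}` ⇒ `(F ∪ {uv}) \ xy` is TTSP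
between `x, y`. [folklore] -/
theorem IsTTSP.reroot_erase {F : Finset (Sym2 V)} (hF : IsTTSP F u v) (hxy : s(x, y) ∈ insert s(u, v) F)
    (hne : insert s(u, v) F ≠ {s(x, y)}) : IsTTSP ((insert s(u, v) F).erase s(x, y)) x y :=
  (hF.insert_edge_of_mem hxy).erase_terminal_edge hxy hne

omit [Fintype V] in
/-- The general AND-drift over the empty free set vanishes. [folklore] -/
theorem andGen_sum_empty (q : ℝ) (A C : Finset (Sym2 V)) (e : Sym2 V) (h : Finset (Sym2 V) → ℝ) :
    ∑ γ ∈ (∅ : Finset (Sym2 V)).powerset,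
        (q ^ (clusterCount (↑(insert e (γ ∪ A)) : BondConfig V) ∅ + clusterCount (↑(∅ \ γ ∪ C) : BondConfig V) ∅) -
            q ^ (clusterCount (↑(insert e (∅ \ γ ∪ A)) : BondConfig V) ∅ + clusterCount (↑(γ ∪ C) : BondConfig V) ∅)) * h γ = 0 := by
  rw [Finset.powerset_empty, Finset.sum_singleton, Finset.sdiff_self]
  ring

omit [Fintype V] in
/-- The rootless general AND-drift over the empty free set vanishes. [folklore] -/
theorem andGen_rootless_sum_empty (q : ℝ) (A C : Finset (Sym2 V)) (h : Finset (Sym2 V) → ℝ) :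
    ∑ γ ∈ (∅ : Finset (Sym2 V)).powerset,
        (q ^ (clusterCount (↑(γ ∪ A) : BondConfig V) ∅ + clusterCount (↑(∅ \ γ ∪ C) : BondConfig V) ∅) -
            q ^ (clusterCount (↑(∅ \ γ ∪ A) : BondConfig V) ∅ + clusterCount (↑(γ ∪ C) : BondConfig V) ∅)) * h γ = 0 := by
  rw [Finset.powerset_empty, Finset.sum_singleton, Finset.sdiff_self]
  ring

omit [Fintype V] in
/-- The rootless general AND-drift with equal attached and contracted sets vanishes termwise. [folklore] -/
theorem andGen_rootless_self (q : ℝ) (N A : Finset (Sym2 V)) (h : Finset (Sym2 V) → ℝ) :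
    ∑ γ ∈ N.powerset,
        (q ^ (clusterCount (↑(γ ∪ A) : BondConfig V) ∅ + clusterCount (↑(N \ γ ∪ A) : BondConfig V) ∅) -
            q ^ (clusterCount (↑(N \ γ ∪ A) : BondConfig V) ∅ + clusterCount (↑(γ ∪ A) : BondConfig V) ∅)) * h γ = 0 := by
  refine Finset.sum_eq_zero fun γ _ => ?_
  rw [add_comm (clusterCount (↑(N \ γ ∪ A) : BondConfig V) ∅), sub_self, zero_mul]

/-- **The doubled root.**  Let `e ∈ N` (the root of the drift is also a free edge) and `N' = N \ e`.  If the drift with root `e` on `N'`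
(attached `A`, contracted `C`) and the rootless drift on `N'` with `e` attached AND contracted (`A ∪ e`, `C ∪ e`) are `≤ 0` on every monotone
test function, then the drift with root `e` on `N` is `≤ 0` on every monotone `h` (`0 < q ≤ 1`): splitting by the `e`-coordinate, the sum is
the first input against `h(· ∪ e)`, plus the second against `h`, plus `∑ (q^{Z̄'+Φ'} - q^{Z̄'+B'})(h(γ' ∪ e) - h(γ'))`, nonpositive termwise since
`k(γ' ∪ C ∪ e) ≤ k(γ' ∪ C)` and `h` is monotone. [cite: Grimmett2006, §1.4 eq. (1.20) (p. 15), Thm. (3.1)(a)] -/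
theorem andGen_doubled {q : ℝ} (hq0 : 0 < q) (hq1 : q ≤ 1) {N A C : Finset (Sym2 V)} (heN : s(u, v) ∈ N)
    (hrec : ∀ h' : Finset (Sym2 V) → ℝ, (∀ ⦃X Y : Finset (Sym2 V)⦄, X ⊆ Y → Y ⊆ N.erase s(u, v) → h' X ≤ h' Y) →
      ∑ γ ∈ (N.erase s(u, v)).powerset,
        (q ^ (clusterCount (↑(insert s(u, v) (γ ∪ A)) : BondConfig V) ∅ + clusterCount (↑(N.erase s(u, v) \ γ ∪ C) : BondConfig V) ∅) -
          q ^ (clusterCount (↑(insert s(u, v) (N.erase s(u, v) \ γ ∪ A)) : BondConfig V) ∅ +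
            clusterCount (↑(γ ∪ C) : BondConfig V) ∅)) * h' γ ≤ 0)
    (hcon : ∀ h' : Finset (Sym2 V) → ℝ, (∀ ⦃X Y : Finset (Sym2 V)⦄, X ⊆ Y → Y ⊆ N.erase s(u, v) → h' X ≤ h' Y) →
      ∑ γ ∈ (N.erase s(u, v)).powerset,
        (q ^ (clusterCount (↑(insert s(u, v) (γ ∪ A)) : BondConfig V) ∅ +
              clusterCount (↑(insert s(u, v) (N.erase s(u, v) \ γ ∪ C)) : BondConfig V) ∅) -
          q ^ (clusterCount (↑(insert s(u, v) (N.erase s(u, v) \ γ ∪ A)) : BondConfig V) ∅ +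
              clusterCount (↑(insert s(u, v) (γ ∪ C)) : BondConfig V) ∅)) * h' γ ≤ 0)
    {h : Finset (Sym2 V) → ℝ} (hmono : ∀ ⦃X Y : Finset (Sym2 V)⦄, X ⊆ Y → Y ⊆ N → h X ≤ h Y) :
    ∑ γ ∈ N.powerset,
        (q ^ (clusterCount (↑(insert s(u, v) (γ ∪ A)) : BondConfig V) ∅ + clusterCount (↑(N \ γ ∪ C) : BondConfig V) ∅) -
            q ^ (clusterCount (↑(insert s(u, v) (N \ γ ∪ A)) : BondConfig V) ∅ + clusterCount (↑(γ ∪ C) : BondConfig V) ∅)) * h γ ≤ 0 := by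
  set N' := N.erase s(u, v) with hN'
  have hN : N = insert s(u, v) N' := (Finset.insert_erase heN).symm
  have heN' : s(u, v) ∉ N' := Finset.notMem_erase _ _
  have hN'N : N' ⊆ N := Finset.erase_subset _ _
  -- (1) the recursive input against `h(· ∪ e)`
  have hZ : ∑ γ ∈ N'.powerset,
      (q ^ (clusterCount (↑(insert s(u, v) (γ ∪ A)) : BondConfig V) ∅ + clusterCount (↑(N' \ γ ∪ C) : BondConfig V) ∅) -
          q ^ (clusterCount (↑(insert s(u, v) (N' \ γ ∪ A)) : BondConfig V) ∅ + clusterCount (↑(γ ∪ C) : BondConfig V) ∅)) *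
        h (insert s(u, v) γ) ≤ 0 :=
    hrec (fun γ => h (insert s(u, v) γ)) fun X Y hXY hY =>
      hmono (Finset.insert_subset_insert _ hXY) (Finset.insert_subset heN (hY.trans hN'N))
  -- (2) the contracted input against `h`
  have hC := hcon h fun X Y hXY hY => hmono hXY (hY.trans hN'N)
  -- (3) split the sum by the `e`-coordinate
  rw [hN, Finset.sum_powerset_insert heN']
  have e1 : ∀ γ ∈ N'.powerset, insert s(u, v) N' \ γ = insert s(u, v) (N' \ γ) := fun γ hγ =>
    Finset.insert_sdiff_of_notMem _ (fun hh => heN' (Finset.mem_powerset.1 hγ hh))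
  have e2 : ∀ γ : Finset (Sym2 V), insert s(u, v) N' \ insert s(u, v) γ = N' \ γ := fun γ => by
    rw [Finset.insert_sdiff_insert, Finset.sdiff_insert_of_notMem heN']
  have e3 : ∀ X : Finset (Sym2 V), insert s(u, v) (insert s(u, v) X ∪ A) = insert s(u, v) (X ∪ A) := fun X => by
    rw [Finset.insert_union, Finset.insert_idem]
  have e4 : ∀ X : Finset (Sym2 V), insert s(u, v) X ∪ C = insert s(u, v) (X ∪ C) := fun X => Finset.insert_union _ _ _
  have hS1 : ∑ γ ∈ N'.powerset,
      (q ^ (clusterCount (↑(insert s(u, v) (γ ∪ A)) : BondConfig V) ∅ + clusterCount (↑(insert s(u, v) N' \ γ ∪ C) : BondConfig V) ∅) -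
          q ^ (clusterCount (↑(insert s(u, v) (insert s(u, v) N' \ γ ∪ A)) : BondConfig V) ∅ + clusterCount (↑(γ ∪ C) : BondConfig V) ∅)) *
        h γ =
      ∑ γ ∈ N'.powerset,
      (q ^ (clusterCount (↑(insert s(u, v) (γ ∪ A)) : BondConfig V) ∅ + clusterCount (↑(insert s(u, v) (N' \ γ ∪ C)) : BondConfig V) ∅) -
          q ^ (clusterCount (↑(insert s(u, v) (N' \ γ ∪ A)) : BondConfig V) ∅ + clusterCount (↑(γ ∪ C) : BondConfig V) ∅)) * h γ := by
    refine Finset.sum_congr rfl fun γ hγ => ?_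
    rw [e1 γ hγ, e3, e4]
  have hS2 : ∑ γ ∈ N'.powerset,
      (q ^ (clusterCount (↑(insert s(u, v) (insert s(u, v) γ ∪ A)) : BondConfig V) ∅ +
            clusterCount (↑(insert s(u, v) N' \ insert s(u, v) γ ∪ C) : BondConfig V) ∅) -
          q ^ (clusterCount (↑(insert s(u, v) (insert s(u, v) N' \ insert s(u, v) γ ∪ A)) : BondConfig V) ∅ +
            clusterCount (↑(insert s(u, v) γ ∪ C) : BondConfig V) ∅)) * h (insert s(u, v) γ) =
      ∑ γ ∈ N'.powerset,
      (q ^ (clusterCount (↑(insert s(u, v) (γ ∪ A)) : BondConfig V) ∅ + clusterCount (↑(N' \ γ ∪ C) : BondConfig V) ∅) -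
          q ^ (clusterCount (↑(insert s(u, v) (N' \ γ ∪ A)) : BondConfig V) ∅ +
            clusterCount (↑(insert s(u, v) (γ ∪ C)) : BondConfig V) ∅)) * h (insert s(u, v) γ) := by
    refine Finset.sum_congr rfl fun γ _ => ?_
    rw [e2 γ, e3, e4]
  rw [hS1, hS2]
  -- (4) the remainder is pointwise nonpositive
  have hB : ∀ X : Finset (Sym2 V), q ^ clusterCount (↑X : BondConfig V) ∅ ≤ q ^ clusterCount (↑(insert s(u, v) X) : BondConfig V) ∅ := by
    intro X
    have i := clusterCount_insert_add_ite X u v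
    exact pow_le_pow_of_le_one hq0.le hq1 (by omega)
  have rem : ∑ γ ∈ N'.powerset,
      (q ^ (clusterCount (↑(insert s(u, v) (N' \ γ ∪ A)) : BondConfig V) ∅ + clusterCount (↑(γ ∪ C) : BondConfig V) ∅) -
        q ^ (clusterCount (↑(insert s(u, v) (N' \ γ ∪ A)) : BondConfig V) ∅ +
          clusterCount (↑(insert s(u, v) (γ ∪ C)) : BondConfig V) ∅)) * (h (insert s(u, v) γ) - h γ) ≤ 0 := by
    refine Finset.sum_nonpos fun γ hγ => ?_
    rw [Finset.mem_powerset] at hγ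
    refine mul_nonpos_of_nonpos_of_nonneg ?_ (sub_nonneg.2 (hmono (Finset.subset_insert _ _) (Finset.insert_subset heN (hγ.trans hN'N))))
    rw [pow_add, pow_add]
    exact sub_nonpos.2 (mul_le_mul_of_nonneg_left (hB (γ ∪ C)) (pow_nonneg hq0.le _))
  have split : ∑ γ ∈ N'.powerset,
        (q ^ (clusterCount (↑(insert s(u, v) (γ ∪ A)) : BondConfig V) ∅ + clusterCount (↑(insert s(u, v) (N' \ γ ∪ C)) : BondConfig V) ∅) -
            q ^ (clusterCount (↑(insert s(u, v) (N' \ γ ∪ A)) : BondConfig V) ∅ + clusterCount (↑(γ ∪ C) : BondConfig V) ∅)) * h γ +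
      ∑ γ ∈ N'.powerset,
        (q ^ (clusterCount (↑(insert s(u, v) (γ ∪ A)) : BondConfig V) ∅ + clusterCount (↑(N' \ γ ∪ C) : BondConfig V) ∅) -
            q ^ (clusterCount (↑(insert s(u, v) (N' \ γ ∪ A)) : BondConfig V) ∅ +
              clusterCount (↑(insert s(u, v) (γ ∪ C)) : BondConfig V) ∅)) * h (insert s(u, v) γ) =
      ∑ γ ∈ N'.powerset,
        (q ^ (clusterCount (↑(insert s(u, v) (γ ∪ A)) : BondConfig V) ∅ + clusterCount (↑(N' \ γ ∪ C) : BondConfig V) ∅) -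
            q ^ (clusterCount (↑(insert s(u, v) (N' \ γ ∪ A)) : BondConfig V) ∅ + clusterCount (↑(γ ∪ C) : BondConfig V) ∅)) *
          h (insert s(u, v) γ) +
      ∑ γ ∈ N'.powerset,
        (q ^ (clusterCount (↑(insert s(u, v) (γ ∪ A)) : BondConfig V) ∅ +
              clusterCount (↑(insert s(u, v) (N' \ γ ∪ C)) : BondConfig V) ∅) -
          q ^ (clusterCount (↑(insert s(u, v) (N' \ γ ∪ A)) : BondConfig V) ∅ +
              clusterCount (↑(insert s(u, v) (γ ∪ C)) : BondConfig V) ∅)) * h γ +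
      ∑ γ ∈ N'.powerset,
        (q ^ (clusterCount (↑(insert s(u, v) (N' \ γ ∪ A)) : BondConfig V) ∅ + clusterCount (↑(γ ∪ C) : BondConfig V) ∅) -
          q ^ (clusterCount (↑(insert s(u, v) (N' \ γ ∪ A)) : BondConfig V) ∅ +
            clusterCount (↑(insert s(u, v) (γ ∪ C)) : BondConfig V) ∅)) * (h (insert s(u, v) γ) - h γ) := by
    rw [← Finset.sum_add_distrib, ← Finset.sum_add_distrib, ← Finset.sum_add_distrib]
    refine Finset.sum_congr rfl fun γ _ => ?_
    ring
  rw [split]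
  linarith

end GenSides

end FK

end Summit.CriticalPhenomena.PercolationContinuityZ3.Theorems

end
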